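import Summits.QuantumFields.YangMills.Theorems.BalabanUVNodesN22EdgeAtW1AdmReadingOfRecord13
import Summits.QuantumFields.YangMills.Theorems.BalabanUVNodesN22EdgeAtW1Reading13CoP
import Summits.QuantumFields.YangMills.Theorems.BalabanUVNodesN22W1StripAdmReading

/-!
# ⁗ (SEPARATION-GUARD) EDITION of 8a″ `BalabanUVNodesN22EdgeAtW1AdmReadingOfRecord13` (p495961) — THE EDGE at the ADMISSIBLE reading of record `ReadingData.ofRecordAdm`.
#
# WHY THIS FILE EXISTS (route `route-QuantumFields-BalabanUVNodes` rev 18; director-ym LINE №136–№138, plan g67 ACK-138, dag-lead WORDS-139∕140, pub-ymgap INBOX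
# l.16256 ∕ l.16518 ∕ l.16567 ∕ l.16541).  def-P11 LOCATED that `Stage13Params.Provisos₁₃.bg` demanded the background-row conclusion at EVERY (2.18)-sequence, where
# print ([Balaban1989LargeFieldII] Thm 1) gives it only at SEPARATED sequences; the gate refuses a same-name in-place body change (D-0009), so def-T's `Node00/Record13`
# v1.2 (p501191) ADDED the print-faithful proviso `Stage13Params.Provisos₁₃Core` (support guard via `Sect2.SeqSeparated`) with its datum `Node00.datumOfRecord₁₃CoP` (`= datumOfRecord₁₃`
# on the old provisos by `rfl`), RR-2 re-keyed the datum key (`Node00/Record13DatumKeyCoP`, p521571: `IsDatumOfRecord₁₃CCoP ∕ COn ∕ CN`, `IsRecordOfRecord₁₃CCoP…`), and the four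
# cruxes were re-minted ⁗ over the new tokens (K3⁗ `SpineGivenEndpointR13Sep`).  A proof of the WEAKER new proviso cannot feed a theorem binding the old one, so every
# storey typed `∀ θ (hP : θ.Provisos₁₃ F N), …` is re-keyed ONCE; this file is the (T-RATE) pen's twin of its own ‴ module under the token map
# `Provisos₁₃ ↦ Provisos₁₃Core` · `datumOfRecord₁₃ ↦ datumOfRecord₁₃CoP` · `(Is|is)DatumOfRecord₁₃C… ↦ …₁₃CCoP…` · `(Is|is)RecordOfRecord₁₃C… ↦ …₁₃CCoP…` and, for THIS seat's
# names, `₁₃ ↦ ₁₃CoP` inserted in the stage-KEYED stems only (`RateReading₁₃`, `rateCarriersOfRecord₁₃`, `RRec₁₃(On)`, `rRec₁₃…`, `readingOfRecord₁₃`, `…datumKey₁₃…`,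
# `n22_tupleReadingOfRecord(On)…`).  EVERYTHING θ-LEVEL IS UNCHANGED AND NOT RE-DECLARED: `Stage13Params`, `u3OfRecord₁₃ θ u k` and its faces, the θ-form slot ∕ edge
# closers `n22At_u3OfRecord₁₃_…` of the ‴ modules carry no proviso and are IMPORTED BY NAME (this module imports its ‴ original) — here: `n22At_u3OfRecord₁₃_ofRecordAdm_of_n18Below_analytic`.  Statements = the ‴ statements
# under the map, proofs = the ‴ proofs verbatim (kernel re-derivations BY NAME); the ‴ module stays in the tree as the aside items' context.  bg-BLIND: like its
# original, nothing here reads any field of the proviso — it enters only as the binder TYPE of the readings and through RR-2's key.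
#
# ITEM IDS: crux names ∕ item ids quoted in the ‴ header below (K0‴–K3‴ = stmt-QuantumFields-19909…19912, `Record13Inhabited`, `SpineGivenEndpointR13`) are the
# rev-16∕17 ones, ASIDES after rev 18; this file is filed `--supports stmt-QuantumFields-20292` (K3⁗ `SpineGivenEndpointR13Sep` per plan's KEY line ∕ dag-lead WORDS-140) as a HELPER —
# count-neutral, no stub closed, N22 NOT discharged, no inhabitant of any ⁗ key claimed (K0⁗ `Record13SepInhabited` OPEN).
#
# ‴ HEADER OF RECORD FOLLOWS (token-mapped; its decl lists are this file's, the θ-only names above excepted):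
#
# BalabanUVNodes ∕ node N22 ⟸ node N18 AT THE ADMISSIBLE W1 READING OF THE STAGE-13 RECORD — the edge N18 → N22 of modules 7″ (§1 STRIP, §2–§4 ANALYTIC (A))
# RE-INSTANTIATED at the Stage-13 reading of record `readingOfRecord₁₃CoP (fun F θ ↦ W1.ReadingData.ofRecordAdm F θ.τ9.M N (S F θ) (sp F θ) …) ℓ₃ ne2 ne1` built from
# node00-def-W1's ADMISSIBLE-SLOT level pairings of record (`Node00/RateRecordW1MapsAdm`, p481475: run-A ∕ run-B backgrounds := the gauge fields whose embedded
# configuration lies IN the space table, `AdmBg F M N sp k`), where dag-n22-c's `pairingCoherence_ofRecordAdm` (`…N22W1StripAdmReading`, p482103) DISCHARGES the coherence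
# binders (C1)(C2), the space-table readings clause holds BY TYPE (`U.2`), and the regularity hypotheses (STRIP ∕ (A)) are asked of ADMISSIBLE backgrounds only

Track A of `YM-PLAN.md` (cell `pub-ymgap`, HUMAN RULING D-0062), R134 seat `pub-ymgap-dag-n22-e` (s2 «`FadingMemory` by name from a modulus + knit at the record»), gen 5,
module 8a″ = the Stage-13 twin (`12 ↦ 13`) of the lineage's module 8a `…N22EdgeAtW1AdmReadingOfRecord12.lean` (p485796) at the record OF RECORD (director-ym LINE №125 ∕ №133 ∕
№135; route rev 17, K3‴ `SpineGivenEndpointR13` = stmt-QuantumFields-19912; dag-lead WORDS-133 ∕ 134 ∕ 135).  THEOREMS ONLY; imports 7″ (`…N22EdgeAtW1Reading13`: the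
W1-pinned ∕ reading-of-record edges at ₁₃, which bring 6″ ∕ 9″c ∕ layer B at ₁₃) and dag-n22-c's `…N22W1StripAdmReading` (p482103: `pairingCoherence_ofRecordAdm`; W1's
`ReadingData.ofRecordAdm`, STAGE-FREE); every proof is ONE application BY NAME.  The maps `S ∕ sp ∕ gauge ∕ T₀ ∕ li ∕ ne2 ∕ ne1` are read PER STAGE-13 TUPLE.  Restate-immune (no
Theses import); COUNT-NEUTRAL; `--supports` K3‴ as a helper.

WHAT IS KERNEL-CHECKED ([folklore]; 0 `def`, 0 `sorry`; the Stage-12 list under `12 ↦ 13`).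
* §1 `n22At_u3OfRecord₁₃_ofRecordAdm_of_n18Below_analytic` (θ-form at one Stage-13 tuple, (A)).
* §2 `s_N22_readingOfRecord₁₃CoPOn_ofRecordAdm_of_s_N18_stripBound` (regime home × STRIP) · `s_N22_readingOfRecord₁₃CoP_ofRecordAdm_of_s_N18_analytic` (canonical home × (A)) ·
  `s_N22_readingOfRecord₁₃CoPOn_ofRecordAdm_of_s_N18_analytic` (regime home × (A)).

HONEST FRAMING.  Coherence and the readings clause are DISCHARGED by construction of the reading; what remains displayed is CONTENT: node N18's stub at the same reading
(dag-n18-d's lane), the pin (J) on the towers `S F θ`, the regularity letter (STRIP-(1.18) per run length, or the analytic sup letter (A)) and the numerals — none has a producer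
at this reading today; the towers `S` are residual DATA; `AdmBg … k` may be EMPTY for a careless table (then the admissible statements are vacuous — dag-n22-c STANDING CHECK (g));
nothing of Bałaban's is asserted or instantiated — NE5 ∕ NE9 NOT PRINTED for d = 4 and NOT PROVED; no inhabitant of `IsDatumOfRecord₁₃CCoP` claimed (K0‴ `Record13Inhabited`,
stmt-QuantumFields-19909, OPEN); N22 NOT discharged; counts UNMOVED (typed 28∕28 · discharged 5∕27, A 5∕28); one finite four-torus programme at fixed `ε` — NOT ℝ⁴, NOT
infinite volume, NOT OS, NOT a mass gap, NOT Clay.  No decl below carries a cite tag.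
-/

noncomputable section

namespace YMDAG.N22

open Set Metric
open scoped BigOperators
open Literature.MathematicalPhysics.QuantumFieldTheory.Balaban1983to89
open Literature.MathematicalPhysics.QuantumFieldTheory.Balaban1983to89.T4Continuum
open Literature.MathematicalPhysics.QuantumFieldTheory.Balaban1983to89.T4OutputRate
open Literature.MathematicalPhysics.QuantumFieldTheory.Balaban1983to89.TreeLengthTorus (torusTreeLen)
open Literature.MathematicalPhysics.QuantumFieldTheory.Balaban1983to89.Node00
  (Stage13Params NE2Objects₁₁ NE3Letters₁₁ MatA ιSU)
open Literature.MathematicalPhysics.QuantumFieldTheory.Balaban1983to89.Node00.Sect2 (domSys CPair ofBackgroundC)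
open Literature.MathematicalPhysics.QuantumFieldTheory.Balaban1983to89.Node00.W1
  (ReadingData LetterInputs ClusterTower functionalC termC AdmBg)
open YMDAG.UVSplit
open YMDAG.N22.W1 (pairingCoherence_ofRecordAdm)

variable {N : ℕ} [NeZero N]

/-! ## §2 Stub level at the reading of record, edition 1, with the admissible W1 component -/

section Stub

variable (S : (F : T4Family) → (θ : Stage13Params F N) → (k : ℕ) → ClusterTower (F.P k) (MatA N) θ.τ9.M)
  (sp : (F : T4Family) → (θ : Stage13Params F N) → (k j : ℕ) → (domSys (F.P k) θ.τ9.M j).Dom → Set (CPair (F.P k) (MatA N)))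
  (gauge : (F : T4Family) → (θ : Stage13Params F N) → (k : ℕ) → GaugeField (F.P k) 0 (Node00.SU N) → GaugeField (F.P k) 0 (Node00.SU N) → ℝ)
  (hg : ∀ (F : T4Family) (θ : Stage13Params F N) (k : ℕ) (U U' : GaugeField (F.P k) 0 (Node00.SU N)), 0 ≤ gauge F θ k U U')
  (T₀ : (F : T4Family) → (θ : Stage13Params F N) → (k : ℕ) → GaugeField (F.P (k + 1)) 0 (Node00.SU N) → GaugeField (F.P k) 0 (Node00.SU N))
  (hT₀ : ∀ (F : T4Family) (θ : Stage13Params F N) (k : ℕ) (U : GaugeField (F.P (k + 1)) 0 (Node00.SU N)),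
    (∀ (j : ℕ) (Y : (domSys (F.P (k + 1)) θ.τ9.M j).Dom), ofBackgroundC (ιSU N) U ∈ sp F θ (k + 1) j Y) →
    ∀ (j : ℕ) (Y : (domSys (F.P k) θ.τ9.M j).Dom), ofBackgroundC (ιSU N) (T₀ F θ k U) ∈ sp F θ k j Y)
  (li : (F : T4Family) → Stage13Params F N → LetterInputs) (ℓ₃ : T4Family → NE3Letters₁₁)
  (ne2 : (F : T4Family) → Stage13Params F N → (ℕ → ℝ) → List (ULoop F) → ℕ → NE2Objects₁₁)
  (ne1 : (F : T4Family) → Stage13Params F N → (ℕ → ℝ) → List (ULoop F) → NE1pCarriers)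

open Classical in
/-- **THE EDGE N18 → N22 AT THE READING OF RECORD WITH THE ADMISSIBLE W1 COMPONENT, REGIME ∕ TUPLE HOME, STRIP CURRENCY.**  For ANY regime `Rg` and
`𝔯 := readingOfRecord₁₃CoP (fun F θ ↦ ReadingData.ofRecordAdm F θ.τ9.M N (S F θ) (sp F θ) …) ℓ₃ ne2 ne1`: `S_N18 (RRec₁₃CoPOn 𝔯 Rg)` + per admissible Stage-13 tuple with provisos IN
`Rg`: the pin (J) for the towers `S F θ`, dag-n22-c's twelve numerals, and per run length `k` STRIP-(1.18) for the terms `E^{(j)}_{S F θ k}(Y; ·; ψ)` at the configurations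
`ψ` of the reading's OWN table `sp F θ k` (young-coupling sections extend holomorphically to an open set ⊇ the closed `li.r`-discs about `]0, θ.γ]`, bound `li.A·e^{−li.κ·ℓ(Y)}`)
⟹ `S_N22 (RRec₁₃CoPOn 𝔯 Rg)`.  Module 7″ §1 ∕ §4 with `hcoh` := dag-n22-c's `pairingCoherence_ofRecordAdm` + (J) and the readings clause BY TYPE (`U.2`). [folklore] -/
theorem s_N22_readingOfRecord₁₃CoPOn_ofRecordAdm_of_s_N18_stripBound (Rg : (F : T4Family) → Stage13Params F N → Prop)
    (h18 : S_N18 (RRec₁₃CoPOn (readingOfRecord₁₃CoP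
      (fun F θ => ReadingData.ofRecordAdm F θ.τ9.M N (S F θ) (sp F θ) (gauge F θ) (hg F θ) (T₀ F θ) (hT₀ F θ) (li F θ)) ℓ₃ ne2 ne1) Rg))
    (hjunk : ∀ (F : T4Family) (θ : Stage13Params F N), θ.Provisos₁₃Core F N → Rg F θ → θ.Admissible F N →
      ∀ (k : ℕ) (X : Node00.W1.Dom (F.P k) θ.τ9.M), k < X.1 → ∀ (g : ℕ → ℝ) (φ : CPair (F.P k) (MatA N)), functionalC (S F θ k) g φ X = 0)
    (hnum : ∀ (F : T4Family) (θ : Stage13Params F N), θ.Provisos₁₃Core F N → Rg F θ → θ.Admissible F N →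
      0 < (li F θ).C₀ ∧ 0 < (li F θ).θ₅ ∧ (li F θ).θ₅ < 1 ∧ 0 ≤ (li F θ).C₅ ∧ 2 * (li F θ).C₅ / (1 - (li F θ).θ₅) ≤ (li F θ).C₀ ∧ 0 < (li F θ).A ∧
        (li F θ).θ₅ ≤ (li F θ).μ ∧ (li F θ).C₀ ≤ 2 * (li F θ).A ∧ 0 < (li F θ).r ∧ 0 < (li F θ).s ∧ (li F θ).s < 1 ∧ 1 ≤ (li F θ).μ)
    (hstrip : ∀ (F : T4Family) (θ : Stage13Params F N), θ.Provisos₁₃Core F N → Rg F θ → θ.Admissible F N → ∀ (k : ℕ),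
      ∀ (j : ℕ) (g : ℕ → ℝ), g ∈ Window θ.γ → ∀ (i : ℕ) (Y : (domSys (F.P k) θ.τ9.M j).Dom) (ψ : CPair (F.P k) (MatA N)), ψ ∈ sp F θ k j Y →
        ∃ (Ec : ℂ → ℂ) (O : Set ℂ), IsOpen O ∧ (∀ t ∈ Ioc (0 : ℝ) θ.γ, closedBall (t : ℂ) (li F θ).r ⊆ O) ∧ DifferentiableOn ℂ Ec O ∧
          (∀ z ∈ O, ‖Ec z‖ ≤ (li F θ).A * Real.exp (-((li F θ).κ * torusTreeLen Y.1))) ∧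
          (∀ t ∈ Ioc (0 : ℝ) θ.γ, Ec t = termC (S F θ k) j Y (Function.update g i t) ψ)) :
    S_N22 (RRec₁₃CoPOn (readingOfRecord₁₃CoP
      (fun F θ => ReadingData.ofRecordAdm F θ.τ9.M N (S F θ) (sp F θ) (gauge F θ) (hg F θ) (T₀ F θ) (hT₀ F θ) (li F θ)) ℓ₃ ne2 ne1) Rg) := by
  refine s_N22_readingOfRecord₁₃CoPOn_of_s_N18_stripBound _ ℓ₃ ne2 ne1 Rg h18 (fun F θ hP hRg hθ => ?_) hnum
    (fun F θ hP hRg hθ k => ⟨sp F θ k, fun j U Y => U.2 j Y, hstrip F θ hP hRg hθ k⟩)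
  obtain ⟨hfst, hdj, hsurj, hbg⟩ := pairingCoherence_ofRecordAdm (N := N) (S F θ) (sp F θ) (gauge F θ) (hg F θ) (T₀ F θ) (hT₀ F θ) (li F θ)
  refine ⟨hfst, hdj, hsurj, hbg, fun k g U X hk => ?_⟩
  show (functionalC (S F θ k) g (ofBackgroundC (ιSU N) U.1) X).re = 0
  rw [hjunk F θ hP hRg hθ k X hk]
  simp

/-- **THE EDGE AT THE READING OF RECORD WITH THE ADMISSIBLE W1 COMPONENT, CANONICAL HOME, ANALYTIC SUP-LETTER CURRENCY** — `S_N18 (RRec₁₃CoP 𝔯)` + per admissible tuple with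
provisos: (J), the eleven numerals, and per run length the analytic letter (A) for `Re E^{(j)}_{S F θ k}(X; ·; (ιU, 0))`, `U` ADMISSIBLE (module 9″c's `hA` literal) ⟹
`S_N22 (RRec₁₃CoP 𝔯)`.  Module 7″'s `s_N22_readingOfRecord₁₃CoP_of_s_N18_analytic` with `hcoh` := `pairingCoherence_ofRecordAdm` + (J). [folklore] -/
theorem s_N22_readingOfRecord₁₃CoP_ofRecordAdm_of_s_N18_analytic
    (h18 : S_N18 (RRec₁₃CoP (readingOfRecord₁₃CoP
      (fun F θ => ReadingData.ofRecordAdm F θ.τ9.M N (S F θ) (sp F θ) (gauge F θ) (hg F θ) (T₀ F θ) (hT₀ F θ) (li F θ)) ℓ₃ ne2 ne1)))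
    (hjunk : ∀ (F : T4Family) (θ : Stage13Params F N), θ.Provisos₁₃Core F N → θ.Admissible F N →
      ∀ (k : ℕ) (X : Node00.W1.Dom (F.P k) θ.τ9.M), k < X.1 → ∀ (g : ℕ → ℝ) (φ : CPair (F.P k) (MatA N)), functionalC (S F θ k) g φ X = 0)
    (hA : ∀ (F : T4Family) (θ : Stage13Params F N), θ.Provisos₁₃Core F N → θ.Admissible F N → ∀ (k : ℕ),
      ∀ g ∈ Window θ.γ, ∀ (U : AdmBg F θ.τ9.M N (sp F θ) k) (X : Node00.W1.Dom (F.P k) θ.τ9.M) (i : ℕ), i < X.1 →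
        ∃ (Fz : ℂ → ℂ) (Dset : Set ℂ), DifferentiableOn ℂ Fz Dset ∧
          (∀ z ∈ Dset, ‖Fz z‖ ≤ (li F θ).A * (li F θ).μ ^ (X.1 - 1 - i) * Real.exp (-((li F θ).κ * (domSys (F.P k) θ.τ9.M X.1).dj X.2))) ∧
          (∀ t ∈ Ioc (0 : ℝ) θ.γ, closedBall (t : ℂ) (li F θ).r ⊆ Dset) ∧
          (∀ t ∈ Ioc (0 : ℝ) θ.γ, Fz t = ((functionalC (S F θ k) (Function.update g i t) (ofBackgroundC (ιSU N) U.1) X).re : ℂ)))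
    (hnum : ∀ (F : T4Family) (θ : Stage13Params F N), θ.Provisos₁₃Core F N → θ.Admissible F N →
      0 < (li F θ).C₀ ∧ 0 < (li F θ).θ₅ ∧ (li F θ).θ₅ < 1 ∧ 0 ≤ (li F θ).C₅ ∧ 2 * (li F θ).C₅ / (1 - (li F θ).θ₅) ≤ (li F θ).C₀ ∧ 0 < (li F θ).A ∧
        (li F θ).θ₅ ≤ (li F θ).μ ∧ (li F θ).C₀ ≤ 2 * (li F θ).A ∧ 0 < (li F θ).r ∧ 0 < (li F θ).s ∧ (li F θ).s < 1) :
    S_N22 (RRec₁₃CoP (readingOfRecord₁₃CoP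
      (fun F θ => ReadingData.ofRecordAdm F θ.τ9.M N (S F θ) (sp F θ) (gauge F θ) (hg F θ) (T₀ F θ) (hT₀ F θ) (li F θ)) ℓ₃ ne2 ne1)) := by
  refine s_N22_readingOfRecord₁₃CoP_of_s_N18_analytic _ ℓ₃ ne2 ne1 h18 (fun F θ hP hθ => ?_)
    (fun F θ hP hθ k g hg' U X i hi => hA F θ hP hθ k g hg' U X i hi) hnum
  obtain ⟨hfst, hdj, hsurj, hbg⟩ := pairingCoherence_ofRecordAdm (N := N) (S F θ) (sp F θ) (gauge F θ) (hg F θ) (T₀ F θ) (hT₀ F θ) (li F θ)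
  refine ⟨hfst, hdj, hsurj, hbg, fun k g U X hk => ?_⟩
  show (functionalC (S F θ k) g (ofBackgroundC (ιSU N) U.1) X).re = 0
  rw [hjunk F θ hP hθ k X hk]
  simp

/-- **THE SAME AT THE REGIME ∕ TUPLE HOME** `RRec₁₃CoPOn 𝔯 Rg` (any `Rg`), analytic currency — module 7″'s `s_N22_readingOfRecord₁₃CoPOn_of_s_N18_analytic`, `hcoh` := `pairingCoherence_ofRecordAdm` + (J). [folklore] -/
theorem s_N22_readingOfRecord₁₃CoPOn_ofRecordAdm_of_s_N18_analytic (Rg : (F : T4Family) → Stage13Params F N → Prop)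
    (h18 : S_N18 (RRec₁₃CoPOn (readingOfRecord₁₃CoP
      (fun F θ => ReadingData.ofRecordAdm F θ.τ9.M N (S F θ) (sp F θ) (gauge F θ) (hg F θ) (T₀ F θ) (hT₀ F θ) (li F θ)) ℓ₃ ne2 ne1) Rg))
    (hjunk : ∀ (F : T4Family) (θ : Stage13Params F N), θ.Provisos₁₃Core F N → Rg F θ → θ.Admissible F N →
      ∀ (k : ℕ) (X : Node00.W1.Dom (F.P k) θ.τ9.M), k < X.1 → ∀ (g : ℕ → ℝ) (φ : CPair (F.P k) (MatA N)), functionalC (S F θ k) g φ X = 0)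
    (hA : ∀ (F : T4Family) (θ : Stage13Params F N), θ.Provisos₁₃Core F N → Rg F θ → θ.Admissible F N → ∀ (k : ℕ),
      ∀ g ∈ Window θ.γ, ∀ (U : AdmBg F θ.τ9.M N (sp F θ) k) (X : Node00.W1.Dom (F.P k) θ.τ9.M) (i : ℕ), i < X.1 →
        ∃ (Fz : ℂ → ℂ) (Dset : Set ℂ), DifferentiableOn ℂ Fz Dset ∧
          (∀ z ∈ Dset, ‖Fz z‖ ≤ (li F θ).A * (li F θ).μ ^ (X.1 - 1 - i) * Real.exp (-((li F θ).κ * (domSys (F.P k) θ.τ9.M X.1).dj X.2))) ∧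
          (∀ t ∈ Ioc (0 : ℝ) θ.γ, closedBall (t : ℂ) (li F θ).r ⊆ Dset) ∧
          (∀ t ∈ Ioc (0 : ℝ) θ.γ, Fz t = ((functionalC (S F θ k) (Function.update g i t) (ofBackgroundC (ιSU N) U.1) X).re : ℂ)))
    (hnum : ∀ (F : T4Family) (θ : Stage13Params F N), θ.Provisos₁₃Core F N → Rg F θ → θ.Admissible F N →
      0 < (li F θ).C₀ ∧ 0 < (li F θ).θ₅ ∧ (li F θ).θ₅ < 1 ∧ 0 ≤ (li F θ).C₅ ∧ 2 * (li F θ).C₅ / (1 - (li F θ).θ₅) ≤ (li F θ).C₀ ∧ 0 < (li F θ).A ∧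
        (li F θ).θ₅ ≤ (li F θ).μ ∧ (li F θ).C₀ ≤ 2 * (li F θ).A ∧ 0 < (li F θ).r ∧ 0 < (li F θ).s ∧ (li F θ).s < 1) :
    S_N22 (RRec₁₃CoPOn (readingOfRecord₁₃CoP
      (fun F θ => ReadingData.ofRecordAdm F θ.τ9.M N (S F θ) (sp F θ) (gauge F θ) (hg F θ) (T₀ F θ) (hT₀ F θ) (li F θ)) ℓ₃ ne2 ne1) Rg) := by
  refine s_N22_readingOfRecord₁₃CoPOn_of_s_N18_analytic _ ℓ₃ ne2 ne1 Rg h18 (fun F θ hP hRg hθ => ?_)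
    (fun F θ hP hRg hθ k g hg' U X i hi => hA F θ hP hRg hθ k g hg' U X i hi) hnum
  obtain ⟨hfst, hdj, hsurj, hbg⟩ := pairingCoherence_ofRecordAdm (N := N) (S F θ) (sp F θ) (gauge F θ) (hg F θ) (T₀ F θ) (hT₀ F θ) (li F θ)
  refine ⟨hfst, hdj, hsurj, hbg, fun k g U X hk => ?_⟩
  show (functionalC (S F θ k) g (ofBackgroundC (ιSU N) U.1) X).re = 0
  rw [hjunk F θ hP hRg hθ k X hk]
  simp

end Stub

end YMDAG.N22

end
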